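import Summits.FinalStateConjecture.FinalStateConjecture.Theorems.EIHFluxBalanceInertialRecessionStubRechart3ClockMap
import Summits.FinalStateConjecture.FinalStateConjecture.Theorems.EIHFluxBalanceInertialRecessionHonestMap

/-!
# Route EIHFluxBalance — `InertialRecession`, re-charting: derivative bounds for the clock map

Helper file for the crux `stmt-FinalStateConjecture-10166`
(`Summit.FinalStateConjecture.FinalStateConjecture.Theses.EIHFluxBalance.InertialRecession`),
line `sublinear-is-free-clean-window-charges`, stub `stub_rechart` (the transfer P2), part G1.

Pointwise bounds, on the rest-frame region `Q(τ₁, R) = {|y⁰ − τ₁| ≤ 1, ‖ỹ‖ ≤ R}`, for the first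
three derivatives of the clock map `T(y) = T₀(y⁰) + frameTilt (Λ̃ (T₀ y⁰)) ỹ` of a hole chart, in
terms of the Lorentz-factor bound `γ`, the radius `R` and a smallness level `δ ≤ 1` of the painted
kinematics after the lab time `S` (`|ũ⁰'|, |ũ⁰''| ≤ δ`, `‖(frameTilt∘Λ̃)^{(k)}‖ ≤ δ`, `k = 1,2,3`):
`‖DT‖ ≤ 5γ(1+R)`, `‖D²T‖ ≤ 3γ²(1+R) δ`, `‖D³T‖ ≤ 8γ³(1+R) δ` (`norm_iteratedFDeriv_clockMap_le`).
Tools: the norm chain rules of `…StubRechart3Chain` (through the time coordinate and through the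
one-variable clock), Leibniz for the pairing with the (linear) rest offset `ỹ`. [folklore]
-/

noncomputable section

set_option linter.dupNamespace false

open Set Filter Function Metric Topology
open scoped ContDiff
open Literature.Geometry.Lorentzian

namespace Summit.FinalStateConjecture.FinalStateConjecture.Theorems.SublinearIsFree.Rechart

/-! ### Generic: composition with the time coordinate, pairing with the rest offset -/

section Generic

variable {G : Type*} [NormedAddCommGroup G] [NormedSpace ℝ G]

/-- The time coordinate `y ↦ y⁰` has first derivative of norm `≤ 1` and vanishing higher
derivatives. [folklore] -/
theorem norm_iteratedFDeriv_apply_zero_le (y : E4) :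
    ‖iteratedFDeriv ℝ 1 (fun y : E4 ↦ y 0) y‖ ≤ 1 ∧ ‖iteratedFDeriv ℝ 2 (fun y : E4 ↦ y 0) y‖ ≤ 0 ∧
      ‖iteratedFDeriv ℝ 3 (fun y : E4 ↦ y 0) y‖ ≤ 0 := by
  have hf : (fun y : E4 ↦ y 0) = (EuclideanSpace.proj (0 : Fin 4) : E4 →L[ℝ] ℝ) := rfl
  rw [hf]
  refine ⟨(norm_iteratedFDeriv_clm_one _ y).trans norm_proj_zero_le, ?_, ?_⟩
  · rw [iteratedFDeriv_clm_add_two _ y 0, norm_zero]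
  · have h := iteratedFDeriv_clm_add_two (EuclideanSpace.proj (0 : Fin 4) : E4 →L[ℝ] ℝ) y 1
    rw [show (1 : ℕ) + 2 = 3 from rfl] at h
    rw [h, norm_zero]

/-- **Derivatives of a one-variable function of the time coordinate**: for `k = 1, 2, 3`,
`‖D^k (y ↦ a (y⁰))(y)‖ ≤ ‖a^{(k)}(y⁰)‖`. [folklore] -/
theorem norm_iteratedFDeriv_comp_apply_zero_le {a : ℝ → G} (ha : ContDiff ℝ 3 a) (y : E4) :
    ‖iteratedFDeriv ℝ 1 (fun y : E4 ↦ a (y 0)) y‖ ≤ ‖deriv a (y 0)‖ ∧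
      ‖iteratedFDeriv ℝ 2 (fun y : E4 ↦ a (y 0)) y‖ ≤ ‖iteratedDeriv 2 a (y 0)‖ ∧
      ‖iteratedFDeriv ℝ 3 (fun y : E4 ↦ a (y 0)) y‖ ≤ ‖iteratedDeriv 3 a (y 0)‖ := by
  obtain ⟨h1, h2, h3⟩ := norm_iteratedFDeriv_apply_zero_le y
  have hT : ContDiff ℝ 3 (fun y : E4 ↦ y 0) := contDiff_apply_zero
  refine ⟨?_, ?_, ?_⟩
  · have := norm_iteratedFDeriv_one_comp_scalar_le (ha.differentiable (by norm_num))
      (hT.differentiable (by norm_num)) y le_rfl h1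
    simpa using this
  · have := norm_iteratedFDeriv_two_comp_scalar_le (ha.of_le (by norm_num)) (hT.of_le (by norm_num))
      y le_rfl le_rfl h1 h2
    simpa using this
  · have := norm_iteratedFDeriv_three_comp_scalar_le ha hT y le_rfl le_rfl le_rfl h1 h2 h3
    simpa using this

/-- The rest offset `y ↦ ỹ` has value of norm `‖ỹ‖`, first derivative of norm `≤ 1` and vanishing
higher derivatives. [folklore] -/
theorem norm_iteratedFDeriv_spatial_le (y : E4) :
    ‖iteratedFDeriv ℝ 0 (fun y : E4 ↦ E4.spatial y) y‖ = ‖E4.spatial y‖ ∧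
      ‖iteratedFDeriv ℝ 1 (fun y : E4 ↦ E4.spatial y) y‖ ≤ 1 ∧
      ‖iteratedFDeriv ℝ 2 (fun y : E4 ↦ E4.spatial y) y‖ = 0 ∧
      ‖iteratedFDeriv ℝ 3 (fun y : E4 ↦ E4.spatial y) y‖ = 0 := by
  have hf : (fun y : E4 ↦ E4.spatial y) = (E4.spatial : E4 →L[ℝ] E3) := rfl
  rw [hf]
  refine ⟨norm_iteratedFDeriv_zero, (norm_iteratedFDeriv_clm_one _ y).trans norm_spatialCLM_le, ?_, ?_⟩
  · rw [iteratedFDeriv_clm_add_two _ y 0, norm_zero]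
  · have h := iteratedFDeriv_clm_add_two (E4.spatial : E4 →L[ℝ] E3) y 1
    rw [show (1 : ℕ) + 2 = 3 from rfl] at h
    rw [h, norm_zero]

/-- **Leibniz for the pairing with the rest offset.** For a `C³` operator field `A : E4 → (E3 →L G)`
and `k = 1, 2, 3`: `‖D(Aỹ)‖ ≤ ‖DA‖‖ỹ‖ + ‖A‖`, `‖D²(Aỹ)‖ ≤ ‖D²A‖‖ỹ‖ + 2‖DA‖`,
`‖D³(Aỹ)‖ ≤ ‖D³A‖‖ỹ‖ + 3‖D²A‖` (all at `y`). [folklore] -/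
theorem norm_iteratedFDeriv_apply_spatial_le {A : E4 → E3 →L[ℝ] G} (hA : ContDiff ℝ 3 A) (y : E4) :
    ‖iteratedFDeriv ℝ 1 (fun y ↦ A y (E4.spatial y)) y‖ ≤
        ‖iteratedFDeriv ℝ 1 A y‖ * ‖E4.spatial y‖ + ‖A y‖ ∧
      ‖iteratedFDeriv ℝ 2 (fun y ↦ A y (E4.spatial y)) y‖ ≤
        ‖iteratedFDeriv ℝ 2 A y‖ * ‖E4.spatial y‖ + 2 * ‖iteratedFDeriv ℝ 1 A y‖ ∧
      ‖iteratedFDeriv ℝ 3 (fun y ↦ A y (E4.spatial y)) y‖ ≤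
        ‖iteratedFDeriv ℝ 3 A y‖ * ‖E4.spatial y‖ + 3 * ‖iteratedFDeriv ℝ 2 A y‖ := by
  obtain ⟨g0, g1, g2, g3⟩ := norm_iteratedFDeriv_spatial_le y
  set B : (E3 →L[ℝ] G) →L[ℝ] E3 →L[ℝ] G := ContinuousLinearMap.id ℝ (E3 →L[ℝ] G) with hB
  have hBn : ‖B‖ ≤ 1 := ContinuousLinearMap.norm_id_le
  have hg : ContDiff ℝ 3 (fun y : E4 ↦ E4.spatial y) := E4.spatial.contDiff
  have hfun : (fun y ↦ A y (E4.spatial y)) = fun y ↦ B (A y) (E4.spatial y) := rfl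
  rw [hfun]
  have hA0 : 0 ≤ ‖A y‖ := norm_nonneg _
  refine ⟨?_, ?_, ?_⟩
  · have h := B.norm_iteratedFDeriv_le_of_bilinear_of_le_one hA hg y (n := 1) (by norm_num) hBn
    refine h.trans ?_
    simp only [Finset.sum_range_succ, Finset.sum_range_zero, zero_add, Nat.choose_zero_right,
      Nat.cast_one, one_mul, Nat.sub_zero, Nat.choose_self, norm_iteratedFDeriv_zero]
    nlinarith [g1, norm_nonneg (iteratedFDeriv ℝ 1 A y), norm_nonneg (E4.spatial y), g0]
  · have h := B.norm_iteratedFDeriv_le_of_bilinear_of_le_one hA hg y (n := 2) (by norm_num) hBn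
    refine h.trans ?_
    simp only [Finset.sum_range_succ, Finset.sum_range_zero, zero_add, Nat.choose_zero_right,
      Nat.cast_one, one_mul, Nat.sub_zero, Nat.choose_self, norm_iteratedFDeriv_zero,
      Nat.choose_one_right, Nat.cast_ofNat, g2, mul_zero, add_zero]
    nlinarith [g1, norm_nonneg (iteratedFDeriv ℝ 1 A y), norm_nonneg (iteratedFDeriv ℝ 2 A y), g0]
  · have h := B.norm_iteratedFDeriv_le_of_bilinear_of_le_one hA hg y (n := 3) le_rfl hBn
    refine h.trans ?_
    simp only [Finset.sum_range_succ, Finset.sum_range_zero, zero_add, Nat.choose_zero_right,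
      Nat.cast_one, one_mul, Nat.sub_zero, Nat.choose_self, norm_iteratedFDeriv_zero,
      Nat.cast_ofNat, show Nat.choose 3 1 = 3 from rfl, show Nat.choose 3 2 = 3 from rfl, g2, g3,
      mul_zero, add_zero]
    nlinarith [g1, norm_nonneg (iteratedFDeriv ℝ 2 A y), norm_nonneg (iteratedFDeriv ℝ 3 A y), g0]

end Generic

/-! ### The one-variable clock -/

section Clock

variable (Λ : ℝ → lorentzGroup) (T₀ : ℝ → ℝ)
  (hΛ : ContDiff ℝ ∞ (fun t ↦ ((Λ t : E4 ≃L[ℝ] E4) : E4 →L[ℝ] E4)))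
  (hT₀ : ContDiff ℝ ∞ T₀) (hclock : ∀ τ, HasDerivAt T₀ (frameVel (Λ (T₀ τ)) 0) τ)
  {γ : ℝ} (hγ1 : 1 ≤ γ) (hu1 : ∀ t, 1 ≤ frameVel (Λ t) 0) (huγ : ∀ t, frameVel (Λ t) 0 ≤ γ)
  {S δ : ℝ} (hδ0 : 0 ≤ δ) (hδ1 : δ ≤ 1)
  (hu' : ∀ s, S ≤ s → ‖deriv (fun t ↦ frameVel (Λ t) 0) s‖ ≤ δ)
  (hu'' : ∀ s, S ≤ s → ‖iteratedDeriv 2 (fun t ↦ frameVel (Λ t) 0) s‖ ≤ δ)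

include hclock in
/-- `T₀' = ũ⁰ ∘ T₀`. [folklore] -/
theorem deriv_clock_eq : deriv T₀ = fun τ ↦ frameVel (Λ (T₀ τ)) 0 := funext fun τ ↦ (hclock τ).deriv

include hΛ in
/-- The painted Lorentz factor is a smooth function of lab time. [folklore] -/
theorem contDiff_frameVel_zero : ContDiff ℝ ∞ fun t ↦ frameVel (Λ t) 0 :=
  contDiff_apply_zero.comp (contDiff_frameVel Λ hΛ)

include hclock hu1 huγ in
/-- `1 ≤ T₀' ≤ γ`. [folklore] -/
theorem deriv_clock_mem (τ : ℝ) : 1 ≤ deriv T₀ τ ∧ deriv T₀ τ ≤ γ := by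
  rw [(hclock τ).deriv]; exact ⟨hu1 _, huγ _⟩

include hΛ hT₀ hclock hγ1 hu1 huγ hδ0 hδ1 hu' hu'' in
/-- **Derivatives of the clock**: `|T₀'| ≤ γ`, `|T₀''(τ)| ≤ γδ`, `|T₀'''(τ)| ≤ 2γ²δ` whenever
`T₀ τ ≥ S`. [folklore] -/
theorem norm_iteratedDeriv_clock_le {τ : ℝ} (hτ : S ≤ T₀ τ) :
    ‖deriv T₀ τ‖ ≤ γ ∧ ‖iteratedDeriv 2 T₀ τ‖ ≤ γ * δ ∧ ‖iteratedDeriv 3 T₀ τ‖ ≤ 2 * γ ^ 2 * δ := by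
  have hf := contDiff_frameVel_zero Λ hΛ
  have hd := deriv_clock_eq Λ T₀ hclock
  obtain ⟨h1, hγ'⟩ := deriv_clock_mem Λ T₀ hclock hu1 huγ τ
  have hT1 : ‖deriv T₀ τ‖ ≤ γ := by
    rw [Real.norm_eq_abs, abs_of_pos (by linarith)]; exact hγ'
  -- `T₀'' = (ũ⁰ ∘ T₀)'`
  have hD1 : ‖iteratedFDeriv ℝ 1 T₀ τ‖ ≤ γ := by
    rw [norm_iteratedFDeriv_eq_norm_iteratedDeriv, iteratedDeriv_one]; exact hT1
  have h2 : ‖iteratedDeriv 2 T₀ τ‖ ≤ γ * δ := by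
    rw [show (2 : ℕ) = 1 + 1 from rfl, iteratedDeriv_succ, iteratedDeriv_one, hd,
      ← iteratedDeriv_one, ← norm_iteratedFDeriv_eq_norm_iteratedDeriv]
    have := norm_iteratedFDeriv_one_comp_scalar_le (hf.differentiable (by simp))
      (hT₀.differentiable (by simp)) τ (hu' _ hτ) hD1
    linarith [mul_comm δ γ]
  have hD2 : ‖iteratedFDeriv ℝ 2 T₀ τ‖ ≤ γ * δ := by
    rw [norm_iteratedFDeriv_eq_norm_iteratedDeriv]; exact h2
  refine ⟨hT1, h2, ?_⟩
  rw [show (3 : ℕ) = 2 + 1 from rfl, iteratedDeriv_succ', hd, ← norm_iteratedFDeriv_eq_norm_iteratedDeriv]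
  · have := norm_iteratedFDeriv_two_comp_scalar_le (hf.of_le (WithTop.coe_le_coe.mpr le_top))
      (hT₀.of_le (WithTop.coe_le_coe.mpr le_top)) τ (hu' _ hτ) (hu'' _ hτ) hD1 hD2
    have hγ0 : 0 ≤ γ := by linarith
    have hγδ : δ * (γ * δ) ≤ γ ^ 2 * δ := by
      nlinarith [mul_nonneg (mul_nonneg hγ0 hδ0) (by linarith : (0:ℝ) ≤ γ - δ)]
    linarith

end Clock

/-! ### A one-variable path read through the clock -/

section ThroughClock

variable {G : Type*} [NormedAddCommGroup G] [NormedSpace ℝ G]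

/-- **Derivatives of `L ∘ T₀`** for a `C³` path `L` with `‖L^{(k)}(s)‖ ≤ δ` (`k = 1,2,3`, `s ≥ S`)
and a clock with `|T₀'| ≤ γ`, `|T₀''| ≤ γδ`, `|T₀'''| ≤ 2γ²δ` at `τ` (`γ ≥ 1`, `δ ≤ 1`):
`‖(L∘T₀)'‖ ≤ γδ`, `‖(L∘T₀)''‖ ≤ 2γ²δ`, `‖(L∘T₀)'''‖ ≤ 6γ³δ`. [folklore] -/
theorem norm_iteratedDeriv_comp_clock_le {L : ℝ → G} {T₀ : ℝ → ℝ} (hL : ContDiff ℝ 3 L)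
    (hT₀ : ContDiff ℝ 3 T₀) {γ δ S : ℝ} (hγ1 : 1 ≤ γ) (hδ0 : 0 ≤ δ) (hδ1 : δ ≤ 1)
    (hL' : ∀ s, S ≤ s → ‖deriv L s‖ ≤ δ) (hL'' : ∀ s, S ≤ s → ‖iteratedDeriv 2 L s‖ ≤ δ)
    (hL''' : ∀ s, S ≤ s → ‖iteratedDeriv 3 L s‖ ≤ δ) {τ : ℝ} (hτ : S ≤ T₀ τ)
    (hT1 : ‖deriv T₀ τ‖ ≤ γ) (hT2 : ‖iteratedDeriv 2 T₀ τ‖ ≤ γ * δ)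
    (hT3 : ‖iteratedDeriv 3 T₀ τ‖ ≤ 2 * γ ^ 2 * δ) :
    ‖deriv (fun t ↦ L (T₀ t)) τ‖ ≤ γ * δ ∧ ‖iteratedDeriv 2 (fun t ↦ L (T₀ t)) τ‖ ≤ 2 * γ ^ 2 * δ ∧
      ‖iteratedDeriv 3 (fun t ↦ L (T₀ t)) τ‖ ≤ 6 * γ ^ 3 * δ := by
  have hD1 : ‖iteratedFDeriv ℝ 1 T₀ τ‖ ≤ γ := by
    rw [norm_iteratedFDeriv_eq_norm_iteratedDeriv, iteratedDeriv_one]; exact hT1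
  have hD2 : ‖iteratedFDeriv ℝ 2 T₀ τ‖ ≤ γ * δ := by
    rw [norm_iteratedFDeriv_eq_norm_iteratedDeriv]; exact hT2
  have hD3 : ‖iteratedFDeriv ℝ 3 T₀ τ‖ ≤ 2 * γ ^ 2 * δ := by
    rw [norm_iteratedFDeriv_eq_norm_iteratedDeriv]; exact hT3
  refine ⟨?_, ?_, ?_⟩
  · rw [← iteratedDeriv_one, ← norm_iteratedFDeriv_eq_norm_iteratedDeriv]
    have := norm_iteratedFDeriv_one_comp_scalar_le (hL.differentiable (by norm_num))
      (hT₀.differentiable (by norm_num)) τ (hL' _ hτ) hD1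
    linarith [mul_comm δ γ]
  · rw [← norm_iteratedFDeriv_eq_norm_iteratedDeriv]
    have := norm_iteratedFDeriv_two_comp_scalar_le (hL.of_le (by norm_num)) (hT₀.of_le (by norm_num))
      τ (hL' _ hτ) (hL'' _ hτ) hD1 hD2
    have hγ0 : 0 ≤ γ := by linarith
    have hγδ : δ * (γ * δ) ≤ γ ^ 2 * δ := by
      nlinarith [mul_nonneg (mul_nonneg hγ0 hδ0) (by linarith : (0:ℝ) ≤ γ - δ)]
    linarith
  · rw [← norm_iteratedFDeriv_eq_norm_iteratedDeriv]
    have := norm_iteratedFDeriv_three_comp_scalar_le hL hT₀ τ (hL' _ hτ) (hL'' _ hτ) (hL''' _ hτ)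
      hD1 hD2 hD3
    have hγ0 : 0 ≤ γ := by linarith
    have hγδ : δ * γ ^ 2 * δ ≤ γ ^ 3 * δ := by
      nlinarith [mul_nonneg (mul_nonneg (by positivity : (0:ℝ) ≤ γ ^ 2) hδ0) (by linarith : (0:ℝ) ≤ γ - δ)]
    have h1 : δ * γ ^ 3 + 3 * δ * γ * (γ * δ) + δ * (2 * γ ^ 2 * δ) ≤ 6 * γ ^ 3 * δ := by
      nlinarith [hγδ]
    linarith

end ThroughClock

/-! ### The clock map -/

section ClockMap

variable (Λ : ℝ → lorentzGroup) (T₀ : ℝ → ℝ)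
  (hΛ : ContDiff ℝ ∞ (fun t ↦ ((Λ t : E4 ≃L[ℝ] E4) : E4 →L[ℝ] E4)))
  (hT₀ : ContDiff ℝ ∞ T₀) (hclock : ∀ τ, HasDerivAt T₀ (frameVel (Λ (T₀ τ)) 0) τ)
  {γ : ℝ} (hγ1 : 1 ≤ γ) (hu1 : ∀ t, 1 ≤ frameVel (Λ t) 0)
  (huγ : ∀ t, |((Λ t : E4 ≃L[ℝ] E4) (E4.basisVector 0)) 0| ≤ γ)
  {S δ : ℝ} (hδ0 : 0 ≤ δ) (hδ1 : δ ≤ 1)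
  (hu' : ∀ s, S ≤ s → ‖deriv (fun t ↦ frameVel (Λ t) 0) s‖ ≤ δ)
  (hu'' : ∀ s, S ≤ s → ‖iteratedDeriv 2 (fun t ↦ frameVel (Λ t) 0) s‖ ≤ δ)
  (hL' : ∀ s, S ≤ s → ‖deriv (fun t ↦ frameTilt (Λ t)) s‖ ≤ δ)
  (hL'' : ∀ s, S ≤ s → ‖iteratedDeriv 2 (fun t ↦ frameTilt (Λ t)) s‖ ≤ δ)
  (hL''' : ∀ s, S ≤ s → ‖iteratedDeriv 3 (fun t ↦ frameTilt (Λ t)) s‖ ≤ δ)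

include hΛ hT₀ hclock hγ1 hu1 huγ hδ0 hδ1 hu' hu'' hL' hL'' hL''' in
/-- **Derivative bounds for the clock map.** On `{‖ỹ‖ ≤ R}` and where `T₀ y⁰ ≥ S`:
`‖DT(y)‖ ≤ 5γ(1+R)`, `‖D²T(y)‖ ≤ 3γ²(1+R)δ`, `‖D³T(y)‖ ≤ 8γ³(1+R)δ`. [folklore] -/
theorem norm_iteratedFDeriv_clockMap_le {R : ℝ} (hR : 0 ≤ R) {y : E4} (hy : ‖E4.spatial y‖ ≤ R)
    (hS : S ≤ T₀ (y 0)) :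
    ‖iteratedFDeriv ℝ 1 (clockMap Λ T₀) y‖ ≤ 5 * γ * (1 + R) ∧
      ‖iteratedFDeriv ℝ 2 (clockMap Λ T₀) y‖ ≤ 3 * γ ^ 2 * (1 + R) * δ ∧
      ‖iteratedFDeriv ℝ 3 (clockMap Λ T₀) y‖ ≤ 8 * γ ^ 3 * (1 + R) * δ := by
  have huγ' : ∀ t, frameVel (Λ t) 0 ≤ γ := fun t ↦ (le_abs_self _).trans (huγ t)
  -- the two parts of the clock map
  set A : E4 → ℝ := fun y ↦ T₀ (y 0) with hA
  set Lc : E4 → E3 →L[ℝ] ℝ := fun y ↦ frameTilt (Λ (T₀ (y 0))) with hLc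
  have hLs : ContDiff ℝ ∞ (fun t ↦ frameTilt (Λ t)) := contDiff_frameTilt Λ hΛ
  have hLT : ContDiff ℝ 3 (fun t ↦ frameTilt (Λ (T₀ t))) :=
    (hLs.comp hT₀).of_le (WithTop.coe_le_coe.mpr le_top)
  have hAs : ContDiff ℝ 3 A := (hT₀.comp contDiff_apply_zero).of_le (WithTop.coe_le_coe.mpr le_top)
  have hLcs : ContDiff ℝ 3 Lc := hLT.comp contDiff_apply_zero
  have hfun : clockMap Λ T₀ = fun y ↦ A y + Lc y (E4.spatial y) := rfl
  -- one-variable bounds at `τ = y 0`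
  obtain ⟨c1, c2, c3⟩ := norm_iteratedDeriv_clock_le Λ T₀ hΛ hT₀ hclock hγ1 hu1 huγ' hδ0 hδ1 hu' hu'' hS
  obtain ⟨l1, l2, l3⟩ := norm_iteratedDeriv_comp_clock_le (hLs.of_le (WithTop.coe_le_coe.mpr le_top))
    (hT₀.of_le (WithTop.coe_le_coe.mpr le_top)) hγ1 hδ0 hδ1 hL' hL'' hL''' hS c1 c2 c3
  -- bounds for `A` and `Lc` on `E4`
  obtain ⟨a1, a2, a3⟩ := norm_iteratedFDeriv_comp_apply_zero_le (hT₀.of_le (WithTop.coe_le_coe.mpr le_top)) y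
  obtain ⟨m1, m2, m3⟩ := norm_iteratedFDeriv_comp_apply_zero_le hLT y
  obtain ⟨p1, p2, p3⟩ := norm_iteratedFDeriv_apply_spatial_le hLcs y
  have hLc0 : ‖Lc y‖ ≤ 4 * γ := by
    refine (norm_frameTilt_le _).trans ((norm_lorentz_le _).trans ?_)
    linarith [huγ (T₀ (y 0))]
  have hm1 : ‖iteratedFDeriv ℝ 1 Lc y‖ ≤ γ * δ := m1.trans l1
  have hm2 : ‖iteratedFDeriv ℝ 2 Lc y‖ ≤ 2 * γ ^ 2 * δ := m2.trans l2
  have hm3 : ‖iteratedFDeriv ℝ 3 Lc y‖ ≤ 6 * γ ^ 3 * δ := m3.trans l3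
  have ha1 : ‖iteratedFDeriv ℝ 1 A y‖ ≤ γ := a1.trans c1
  have ha2 : ‖iteratedFDeriv ℝ 2 A y‖ ≤ γ * δ := a2.trans c2
  have ha3 : ‖iteratedFDeriv ℝ 3 A y‖ ≤ 2 * γ ^ 2 * δ := a3.trans c3
  -- sum rule
  have hA' : ContDiff ℝ ∞ A := hT₀.comp contDiff_apply_zero
  have hB' : ContDiff ℝ ∞ (fun y ↦ Lc y (E4.spatial y)) :=
    ((hLs.comp hT₀).comp contDiff_apply_zero).clm_apply E4.spatial.contDiff
  have hadd : ∀ k : ℕ, iteratedFDeriv ℝ k (clockMap Λ T₀) y =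
      iteratedFDeriv ℝ k A y + iteratedFDeriv ℝ k (fun y ↦ Lc y (E4.spatial y)) y := fun k ↦ by
    rw [hfun]
    exact iteratedFDeriv_add_apply (hA'.of_le (WithTop.coe_le_coe.mpr le_top)).contDiffAt
      (hB'.of_le (WithTop.coe_le_coe.mpr le_top)).contDiffAt
  have hγ0 : 0 ≤ γ := by linarith
  have hγδ0 : 0 ≤ γ * δ := mul_nonneg hγ0 hδ0
  have hγ2 : γ ≤ γ ^ 2 := by nlinarith
  have hγ3 : γ ^ 2 ≤ γ ^ 3 := by nlinarith
  refine ⟨?_, ?_, ?_⟩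
  · rw [hadd 1]
    refine (norm_add_le _ _).trans ?_
    have e1 : ‖iteratedFDeriv ℝ 1 Lc y‖ * ‖E4.spatial y‖ ≤ γ * δ * R :=
      mul_le_mul hm1 hy (norm_nonneg _) hγδ0
    have e2 : γ * δ * R ≤ γ * R := mul_le_mul_of_nonneg_right (mul_le_of_le_one_right hγ0 hδ1) hR
    have e3 : 0 ≤ γ * R := mul_nonneg hγ0 hR
    linarith [p1, ha1, hLc0]
  · rw [hadd 2]
    refine (norm_add_le _ _).trans ?_
    have e1 : ‖iteratedFDeriv ℝ 2 Lc y‖ * ‖E4.spatial y‖ ≤ 2 * γ ^ 2 * δ * R :=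
      mul_le_mul hm2 hy (norm_nonneg _) (by positivity)
    have e2 : γ * δ ≤ γ ^ 2 * δ := mul_le_mul_of_nonneg_right hγ2 hδ0
    have e3 : 0 ≤ γ ^ 2 * δ * R := mul_nonneg (mul_nonneg (sq_nonneg γ) hδ0) hR
    linarith [p2, ha2, hm1, e1, e2, e3]
  · rw [hadd 3]
    refine (norm_add_le _ _).trans ?_
    have e1 : ‖iteratedFDeriv ℝ 3 Lc y‖ * ‖E4.spatial y‖ ≤ 6 * γ ^ 3 * δ * R :=
      mul_le_mul hm3 hy (norm_nonneg _) (by positivity)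
    have e2 : γ ^ 2 * δ ≤ γ ^ 3 * δ := mul_le_mul_of_nonneg_right hγ3 hδ0
    have e3 : 0 ≤ γ ^ 3 * δ * R := mul_nonneg (mul_nonneg (pow_nonneg hγ0 3) hδ0) hR
    linarith [p3, ha3, hm2, e1, e2, e3]

end ClockMap

/-- Registered one-line form (worker carrier `rechart_norm_iteratedFDeriv_apply_zero_le`). [folklore] -/
theorem rechart_norm_iteratedFDeriv_apply_zero_le : open Literature.Geometry.Lorentzian in ∀ (y : E4), ‖iteratedFDeriv ℝ 1 (fun y : E4 ↦ y 0) y‖ ≤ 1 ∧ ‖iteratedFDeriv ℝ 2 (fun y : E4 ↦ y 0) y‖ ≤ 0 ∧ ‖iteratedFDeriv ℝ 3 (fun y : E4 ↦ y 0) y‖ ≤ 0 := norm_iteratedFDeriv_apply_zero_le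

end Summit.FinalStateConjecture.FinalStateConjecture.Theorems.SublinearIsFree.Rechart

end
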